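import Summits.QuantumFields.YangMills.Theorems.BalabanUVNodesN15PartitionLattice
import HarnessLib

/-!
# THE QUADRATIC PARTITION OF UNITY (2.36), V: SUPPORTS — the sampled `h_k` vanishes off the open cube `{x : |v_K(ξ_ν x − k_ν)| < 1 ∀ν}`, its one-step difference quotients off its one-step
# neighbourhood, so ANY cut-off `χ` equal to `1` there satisfies FILE 63's support identities `M_h∘M_χ = M_h`, `M_{∇h}∘M_χ = M_{∇h}`, `M_{∇⁻h}∘M_χ = M_{∇⁻h}`, `M_{∇*∇h}∘M_χ = M_{∇*∇h}`
# (dag-n15-c g11, FILE 65; dag-n15-a's (γ) of bus l.28577; N15 = NE2, s1 «background-layer OPERATOR ingredient»)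

Cell `pub-ymgap`, seat `pub-ymgap-dag-n15-c` (R134 (a); HUMAN RULING D-0062), generation 11.  `bears_on: R4∕N15 · K3⁷ SpineGivenEndpointR13SepCoPH (stmt-QuantumFields-20544)`.
Filed `--supports stmt-QuantumFields-20544 --as helper` — COUNT-NEUTRAL.  Theorems only (0 `def`, 0 `sorry`).  Imports BY NAME FILE 61 `…N15PartitionLattice` (`hcube`, `thetaPer`, `cenRep`; FILE 59
`thetaP_eq_zero_of_one_le_abs`; g8 `fgrad`∕`bgrad`∕`fgradAdj`, `mulOp`).

WHY.  FILE 63 (`hasMaj_commOp_lapOp_comp_of_cut`, `parametrix_cut`, `hasMaj_*_of_cutRows`) inserts a cut-off `χ_□` behind the partition's coefficients and needs the identities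
`mulOp a ∘ₗ mulOp χ = mulOp a` for `a ∈ {h, ∇_μh, ∇⁻_μh, ∇*_μ∇_μh}` — i.e. `χ = 1` on the supports.  THIS FILE: ★ `mulOp_comp_mulOp_of_support` (the identity from `a x ≠ 0 ⟹ χ x = 1`); ★
`abs_cenRep_lt_one_of_hcube_ne_zero` (support of `h_k = hcube K ξ k`: every coordinate within circle distance `< 1` of the centre); ★★ `hcube_cut`, `fgrad_hcube_cut`, `bgrad_hcube_cut`,
`fgradAdj_fgrad_hcube_cut` — the four identities for ANY `χ` with `χ x = 1` whenever `x`, `e_μx` or `e_μ⁻¹x` lies in the open cube (so a cut-off one lattice step wider than the cube serves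
every direction `μ` at once).

HONEST FRAMING ∕ LIMITS.  Elementary support bookkeeping; (2.36) p.229 = SHAPE; nothing of [B6]∕[B9] asserted.  NE2⁺ NOT PRINTED, NOT proved; N15 NOT discharged; counts of record UNMOVED
(typed 28∕28 · discharged 5∕27); one finite 𝕋⁴ at fixed ε — NOT infinite volume, NOT OS on ℝ⁴, NOT a mass gap, NOT Clay; R4 closes the conditional finite-𝕋⁴ rung `BalabanLadder.UV` only.
-/

noncomputable section

namespace Summit.QuantumFields.YangMills.BalabanUVNodes.N15.Gluing

open Literature.MathematicalPhysics.QuantumFieldTheory.Balaban1983to89.B6Prop26Gluing (mulOp mulOp_apply)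
open Summit.QuantumFields.YangMills.BalabanUVNodes.N15.BackgroundLayer (fgrad fgradAdj bgrad fgrad_apply fgradAdj_apply bgrad_apply)

section Support

variable {X : Type}

/-- ★ **CUT BEHIND A COEFFICIENT**: if `χ = 1` wherever `a ≠ 0`, then `M_a∘M_χ = M_a`. [folklore] -/
theorem mulOp_comp_mulOp_of_support {a χ : X → ℝ} (h : ∀ x, a x ≠ 0 → χ x = 1) : mulOp a ∘ₗ mulOp χ = mulOp a := by
  refine LinearMap.ext fun f => funext fun x => ?_
  simp only [LinearMap.comp_apply, mulOp_apply]
  by_cases ha : a x = 0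
  · rw [ha, zero_mul, zero_mul]
  · rw [h x ha, one_mul]

variable {J : Type} [Fintype J] (K : ℕ) (ξ : J → X → ℝ)

/-- ★ **SUPPORT OF THE SAMPLED PARTITION**: `h_k(x) ≠ 0` forces every coordinate into the open cube, `|v_K(ξ_ν x − k_ν)| < 1`. [cite: Balaban1984PropagatorsII, (2.36) p.229 (supp h_□ ⊂ □: shape)] -/
theorem abs_cenRep_lt_one_of_hcube_ne_zero {k : J → ZMod K} {x : X} (h : hcube K ξ k x ≠ 0) (ν : J) : |cenRep K (ξ ν x - ((k ν).val : ℝ))| < 1 := by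
  by_contra hc
  push Not at hc
  refine h (Finset.prod_eq_zero (Finset.mem_univ ν) ?_)
  unfold thetaPer
  exact thetaP_eq_zero_of_one_le_abs hc

variable (e : J → X ≃ X) (μ : J) {χ : X → ℝ} {k : J → ZMod K}

/-- Using the cut-off hypothesis (`χ x = 1` whenever `x`, `e_μ x` or `e_μ⁻¹ x` lies in the open cube of `k`) at a point where `h_k ≠ 0`. [folklore] -/
theorem chi_eq_one_of_hcube_ne_zero {x x₀ : X} (hχ : ∀ x : X, (∃ x₀ : X, (x₀ = x ∨ x₀ = e μ x ∨ x₀ = (e μ).symm x) ∧ ∀ ν, |cenRep K (ξ ν x₀ - ((k ν).val : ℝ))| < 1) → χ x = 1)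
    (hx₀ : x₀ = x ∨ x₀ = e μ x ∨ x₀ = (e μ).symm x) (hne : hcube K ξ k x₀ ≠ 0) : χ x = 1 :=
  hχ x ⟨x₀, hx₀, abs_cenRep_lt_one_of_hcube_ne_zero K ξ hne⟩

/-- ★★ `M_{h_k}∘M_χ = M_{h_k}` (FILE 63's `hcut`). [folklore] -/
theorem hcube_cut (hχ : ∀ x : X, (∃ x₀ : X, (x₀ = x ∨ x₀ = e μ x ∨ x₀ = (e μ).symm x) ∧ ∀ ν, |cenRep K (ξ ν x₀ - ((k ν).val : ℝ))| < 1) → χ x = 1) :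
    mulOp (hcube K ξ k) ∘ₗ mulOp χ = mulOp (hcube K ξ k) :=
  mulOp_comp_mulOp_of_support fun _ hx => chi_eq_one_of_hcube_ne_zero K ξ e μ hχ (Or.inl rfl) hx

/-- ★★ `M_{∇_μh_k}∘M_χ = M_{∇_μh_k}` (FILE 63's `hs1`). [folklore] -/
theorem fgrad_hcube_cut (n : ℝ) (hχ : ∀ x : X, (∃ x₀ : X, (x₀ = x ∨ x₀ = e μ x ∨ x₀ = (e μ).symm x) ∧ ∀ ν, |cenRep K (ξ ν x₀ - ((k ν).val : ℝ))| < 1) → χ x = 1) :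
    mulOp (fgrad n (e μ) (hcube K ξ k)) ∘ₗ mulOp χ = mulOp (fgrad n (e μ) (hcube K ξ k)) := by
  refine mulOp_comp_mulOp_of_support fun x hx => ?_
  rw [fgrad_apply] at hx
  by_cases h1 : hcube K ξ k (e μ x) = 0
  · by_cases h0 : hcube K ξ k x = 0
    · exact absurd (by rw [h1, h0]; ring) hx
    · exact chi_eq_one_of_hcube_ne_zero K ξ e μ hχ (Or.inl rfl) h0
  · exact chi_eq_one_of_hcube_ne_zero K ξ e μ hχ (Or.inr (Or.inl rfl)) h1

/-- ★★ `M_{∇⁻_μh_k}∘M_χ = M_{∇⁻_μh_k}` (FILE 63's `hs1b`). [folklore] -/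
theorem bgrad_hcube_cut (n : ℝ) (hχ : ∀ x : X, (∃ x₀ : X, (x₀ = x ∨ x₀ = e μ x ∨ x₀ = (e μ).symm x) ∧ ∀ ν, |cenRep K (ξ ν x₀ - ((k ν).val : ℝ))| < 1) → χ x = 1) :
    mulOp (bgrad n (e μ) (hcube K ξ k)) ∘ₗ mulOp χ = mulOp (bgrad n (e μ) (hcube K ξ k)) := by
  refine mulOp_comp_mulOp_of_support fun x hx => ?_
  rw [bgrad_apply] at hx
  by_cases h1 : hcube K ξ k ((e μ).symm x) = 0
  · by_cases h0 : hcube K ξ k x = 0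
    · exact absurd (by rw [h1, h0]; ring) hx
    · exact chi_eq_one_of_hcube_ne_zero K ξ e μ hχ (Or.inl rfl) h0
  · exact chi_eq_one_of_hcube_ne_zero K ξ e μ hχ (Or.inr (Or.inr rfl)) h1

/-- ★★ `M_{∇*_μ∇_μh_k}∘M_χ = M_{∇*_μ∇_μh_k}` (FILE 63's `hs2`). [folklore] -/
theorem fgradAdj_fgrad_hcube_cut (n : ℝ) (hχ : ∀ x : X, (∃ x₀ : X, (x₀ = x ∨ x₀ = e μ x ∨ x₀ = (e μ).symm x) ∧ ∀ ν, |cenRep K (ξ ν x₀ - ((k ν).val : ℝ))| < 1) → χ x = 1) :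
    mulOp (fgradAdj n (e μ) (fgrad n (e μ) (hcube K ξ k))) ∘ₗ mulOp χ = mulOp (fgradAdj n (e μ) (fgrad n (e μ) (hcube K ξ k))) := by
  refine mulOp_comp_mulOp_of_support fun x hx => ?_
  rw [fgradAdj_apply, fgrad_apply, fgrad_apply, Equiv.apply_symm_apply] at hx
  by_cases h1 : hcube K ξ k (e μ x) = 0
  · by_cases h2 : hcube K ξ k ((e μ).symm x) = 0
    · by_cases h0 : hcube K ξ k x = 0
      · exact absurd (by rw [h1, h2, h0]; ring) hx
      · exact chi_eq_one_of_hcube_ne_zero K ξ e μ hχ (Or.inl rfl) h0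
    · exact chi_eq_one_of_hcube_ne_zero K ξ e μ hχ (Or.inr (Or.inr rfl)) h2
  · exact chi_eq_one_of_hcube_ne_zero K ξ e μ hχ (Or.inr (Or.inl rfl)) h1

end Support

end Summit.QuantumFields.YangMills.BalabanUVNodes.N15.Gluing

end
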